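import Summits.AtomisticToContinuum.FouriersLaw.Theorems.ParityLiouvilleSeedWindowLimitContinuity

/-!
# The bulk bond currents of a steady state and the centre current (helper for `WindowLimit`)

Helper file for the route item `ParityLiouvilleSeed.WindowLimit` (`stmt-AtomisticToContinuum-13982`).

* `pinnedChain_integral_bondCurrent_succ_eq`, `pinnedChain_integral_bondCurrent_eq_of_bulk` — for the
  pinned chain with ARBITRARY real parameters and a weak steady state with all per-site moments, all BULK
  bond currents `∫ j_i dμ`, `1 ≤ i ≤ N - 3`, agree (weak stationarity tested on the energy density
  `h_j ∘ embed`, via the sign-free `integral_generator_eq_zero_of_polyGrowth`, and the continuity equation);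
* `abs_bondCurrent_term_le`, `pinnedChain_abs_integral_bondCurrent_le` — every mean bond current is
  bounded uniformly in `N` by the site-uniform second and fourth moments;
* `centre_current_lower_bound` — `(N-1)|totalCurrent(μ_N)/(N-1)| ≤ (N-3)|J_centre(μ_N)| + B` for `N ≥ 6`
  with `B` uniform in `N` (the `N-3` bulk bonds carry the centre current, the two boundary bonds are
  bounded, the last index carries no bond).

Nothing here closes an item.
-/

noncomputable section

namespace Summit.AtomisticToContinuum.FouriersLaw.Theorems.WindowLimit

open MeasureTheory Filter Topology Set
open scoped ContDiff
open Literature.MathematicalPhysics.KineticTheory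
open Literature.MathematicalPhysics.KineticTheory.HeatConduction

variable {N : ℕ}

/-! ### Bulk bond currents of a steady state of the pinned chain agree -/

section Pinned

variable {ω₂ lam β γ : ℝ}

/-- **Bulk bond currents of a weak steady state agree** (pinned chain, ARBITRARY real parameters): if
`μ` is a weak steady state of the `N`-chain with all per-site polynomial moments, then
`∫ j_{j-1} dμ = ∫ j_j dμ` for every `2 ≤ j ≤ N - 3` — weak stationarity tested on the energy density
`h_j ∘ embed` (a smooth bulk observable of polynomial growth not touching the bath momenta) and the
continuity equation `𝒜 h_j = j_{j-1} - j_j`. [Bonetto–Lebowitz–Rey-Bellet 2000, §5.2 eqs. (25)–(27)]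
[folklore] -/
theorem pinnedChain_integral_bondCurrent_succ_eq (ω₂ lam β γ T_L T_R : ℝ) {N : ℕ}
    {μ : Measure (PhaseSpace N)} (hμ : (pinnedChain ω₂ lam β γ).IsSteadyState N T_L T_R μ)
    (hmom : ∀ (K : ℕ) (i : Fin N), Integrable (fun x : PhaseSpace N => |x.1 i| ^ K + |x.2 i| ^ K) μ)
    (j : Fin N) (hj1 : 2 ≤ j.val) (hj2 : j.val + 3 ≤ N) :
    ∫ x, (pinnedChain ω₂ lam β γ).bondCurrent N ⟨j.val - 1, by omega⟩ x ∂μ =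
      ∫ x, (pinnedChain ω₂ lam β γ).bondCurrent N j x ∂μ := by
  set P := pinnedChain ω₂ lam β γ with hP
  haveI := hμ.1
  have hU : ContDiff ℝ ∞ P.U := pinnedChain_contDiff_U ω₂ lam β γ
  have hV : ContDiff ℝ ∞ P.V := pinnedChain_contDiff_V ω₂ lam β γ
  have hUd : Differentiable ℝ P.U := hU.differentiable (by simp)
  have hVd : Differentiable ℝ P.V := hV.differentiable (by simp)
  -- the observable: energy density at site `j`, read through the embedding with centre `0`
  set g : (Fin (2 + 1) → ℝ × ℝ) → ℝ := fun y => (y 1).2 ^ 2 / 2 + P.U (y 1).1 +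
    (P.V ((y 2).1 - (y 1).1) + P.V ((y 1).1 - (y 0).1)) / 2 with hg
  have hgs : ContDiff ℝ ∞ g := by
    have h1 : ∀ k : Fin (2 + 1), ContDiff ℝ ∞ fun y : Fin (2 + 1) → ℝ × ℝ => (y k).1 := fun k =>
      contDiff_fst.comp (contDiff_apply ℝ (ℝ × ℝ) k)
    have h2 : ∀ k : Fin (2 + 1), ContDiff ℝ ∞ fun y : Fin (2 + 1) → ℝ × ℝ => (y k).2 := fun k =>
      contDiff_snd.comp (contDiff_apply ℝ (ℝ × ℝ) k)
    exact ((((h2 1).pow 2).div_const 2).add (hU.comp (h1 1))).add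
      (((hV.comp ((h1 2).sub (h1 1))).add (hV.comp ((h1 1).sub (h1 0)))).div_const 2)
  have hfe : (fun σ => P.energyDensityZ σ (j : ℤ)) = g ∘ boxRestrictAt ((j : ℤ) - 1) 2 :=
    energyDensityZ_eq_comp_box P (j : ℤ)
  set w : PhaseSpace N → ℝ := (g ∘ boxRestrictAt ((j : ℤ) - 1) 2) ∘ embed N 0 with hw
  have hc : (1 : ℤ) ≤ ((j : ℤ) - 1) + (0 : ℕ) := by push_cast; omega
  have hN : ((j : ℤ) - 1) + (0 : ℕ) + (2 : ℕ) + 2 ≤ N := by push_cast; omega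
  have hws : ContDiff ℝ ∞ w := contDiff_comp_embed (by push_cast; omega) (by push_cast; omega) hgs
  have h0 : ∀ i : Fin N, i.val = 0 → ∀ x, partialP i w x = 0 := fun i hi x =>
    partialP_comp_embed_eq_zero_of_bath hc hN g i (Or.inl hi) x
  have h1 : ∀ i : Fin N, i.val = N - 1 → ∀ x, partialP i w x = 0 := fun i hi x =>
    partialP_comp_embed_eq_zero_of_bath hc hN g i (Or.inr hi) x
  -- `L w = (j_{j-1} - j_j)`
  have hjm1 : (j.val - 1 : ℕ) + 1 < N := by omega
  have hLw : ∀ x, P.generator N T_L T_R w x =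
      P.bondCurrent N ⟨j.val - 1, by omega⟩ x - P.bondCurrent N j x := by
    intro x
    rw [hw, generator_comp_embed_eq_liouvilleZ P hUd hVd T_L T_R hc hN g x, ← hfe,
      liouvilleZ_energyDensityZ P hUd hVd]
    have e1 : P.bondCurrentZ (embed N 0 x) ((j : ℤ) - 1) = P.bondCurrent N ⟨j.val - 1, by omega⟩ x := by
      have h := bondCurrentZ_embed P N 0 x ⟨j.val - 1, by omega⟩ hjm1
      have hc' : (((⟨j.val - 1, by omega⟩ : Fin N) : ℕ) : ℤ) - (0 : ℕ) = (j : ℤ) - 1 := by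
        have : ((j.val - 1 : ℕ) : ℤ) = (j.val : ℤ) - 1 := by omega
        simp [this]
      rwa [hc'] at h
    have e2 : P.bondCurrentZ (embed N 0 x) (j : ℤ) = P.bondCurrent N j x := by
      have h := bondCurrentZ_embed P N 0 x j (by omega)
      simpa using h
    rw [e1, e2]
  -- growth bounds
  have hwb : ∀ x, |w x| ≤ (1 + |ω₂| + |lam| + 4 + 8 * |β|) * (1 + ‖x‖) ^ 4 := by
    intro x
    have h := pinnedChain_abs_energyDensityZ_embed_le ω₂ lam β γ N 0 x j (by omega) (by omega)
    have e : w x = P.energyDensityZ (embed N 0 x) ((j : ℤ) - (0 : ℕ)) := by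
      rw [hw, Function.comp_apply, ← hfe]; simp
    rwa [e]
  have hLwb : ∀ x, |P.generator N T_L T_R w x| ≤ (2 * (2 + 8 * |β|)) * (1 + ‖x‖) ^ 4 := by
    intro x
    rw [hLw x]
    have a1 := pinnedChain_abs_bondCurrent_le_pow ω₂ lam β γ x ⟨j.val - 1, by omega⟩
    have a2 := pinnedChain_abs_bondCurrent_le_pow ω₂ lam β γ x j
    calc _ ≤ _ := abs_sub _ _
      _ ≤ _ := add_le_add a1 a2
      _ = _ := by ring
  -- common constant
  set C : ℝ := max (1 + |ω₂| + |lam| + 4 + 8 * |β|) (2 * (2 + 8 * |β|)) with hC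
  have hwb' : ∀ x, |w x| ≤ C * (1 + ‖x‖) ^ 4 := fun x =>
    (hwb x).trans (mul_le_mul_of_nonneg_right (le_max_left _ _) (by positivity))
  have hLwb' : ∀ x, |P.generator N T_L T_R w x| ≤ C * (1 + ‖x‖) ^ 4 := fun x =>
    (hLwb x).trans (mul_le_mul_of_nonneg_right (le_max_right _ _) (by positivity))
  have hzero := integral_generator_eq_zero_of_polyGrowth P hU hV T_L T_R
    (fun i x => pinnedChain_abs_partialQ_hamiltonian_le ω₂ lam β γ x i) μ hμ.2.1
    (fun K => integrable_one_add_norm_pow μ K (hmom K)) hws h0 h1 hwb' hLwb'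
  simp only [hLw] at hzero
  rw [integral_sub (hμ.2.2 _) (hμ.2.2 _)] at hzero
  linarith

/-- **All bulk bond currents agree**: `∫ j_i dμ = ∫ j_k dμ` for `1 ≤ i, k ≤ N - 3`. [folklore] -/
theorem pinnedChain_integral_bondCurrent_eq_of_bulk (ω₂ lam β γ T_L T_R : ℝ) {N : ℕ}
    {μ : Measure (PhaseSpace N)} (hμ : (pinnedChain ω₂ lam β γ).IsSteadyState N T_L T_R μ)
    (hmom : ∀ (K : ℕ) (i : Fin N), Integrable (fun x : PhaseSpace N => |x.1 i| ^ K + |x.2 i| ^ K) μ)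
    (i k : Fin N) (hi1 : 1 ≤ i.val) (hik : i.val ≤ k.val) (hk : k.val + 3 ≤ N) :
    ∫ x, (pinnedChain ω₂ lam β γ).bondCurrent N i x ∂μ = ∫ x, (pinnedChain ω₂ lam β γ).bondCurrent N k x ∂μ := by
  -- induction on the distance `k - i`
  obtain ⟨d, hd⟩ : ∃ d, k.val = i.val + d := ⟨k.val - i.val, by omega⟩
  induction d generalizing k with
  | zero =>
    have : k = i := Fin.ext (by omega)
    rw [this]
  | succ d ih =>
    have hk' : i.val + d < N := by omega
    have h1 := ih ⟨i.val + d, hk'⟩ (by simp) (by simp; omega) rfl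
    have h2 := pinnedChain_integral_bondCurrent_succ_eq ω₂ lam β γ T_L T_R hμ hmom k (by omega) hk
    have : (⟨k.val - 1, by omega⟩ : Fin N) = ⟨i.val + d, hk'⟩ := Fin.ext (by simp; omega)
    rw [this] at h2
    rw [h1, h2]

end Pinned


/-! ### The boundary bonds and the centre current -/

/-- `xy ≤ (x² + y²)/2`. [folklore] -/
theorem mul_le_half_add_sq (x y : ℝ) : x * y ≤ (x ^ 2 + y ^ 2) / 2 := by nlinarith [sq_nonneg (x - y)]

/-- **Pointwise moment bound for the bond current** `j = -½(p₁ + p₂) V'(q₂ - q₁)`, `V'(r) = r + βr³`: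
`|j| ≤ (1 + 6|β|) ((q₁² + p₁² + q₂² + p₂²) + (q₁⁴ + p₁⁴ + q₂⁴ + p₂⁴))` (only pure powers of single
coordinates, so that site-uniform moment bounds integrate it uniformly in `N`). [folklore] -/
theorem abs_bondCurrent_term_le (β p₁ p₂ q₁ q₂ : ℝ) :
    |(p₁ + p₂) / 2 * (q₂ - q₁ + β * (q₂ - q₁) ^ 3)| ≤
      (1 + 6 * |β|) * ((|q₁| ^ 2 + |p₁| ^ 2 + (|q₂| ^ 2 + |p₂| ^ 2)) +
        (|q₁| ^ 4 + |p₁| ^ 4 + (|q₂| ^ 4 + |p₂| ^ 4))) := by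
  set a : ℝ := |p₁ + p₂| / 2 with ha
  set r : ℝ := q₂ - q₁ with hr
  have ha0 : 0 ≤ a := by positivity
  have hβ0 : 0 ≤ |β| := abs_nonneg _
  have hp4 : ∀ t : ℝ, |t| ^ 4 = t ^ 4 := fun t => by
    have e : |t| ^ 4 = (|t| ^ 2) ^ 2 := by ring
    rw [e, sq_abs]; ring
  simp only [sq_abs, hp4]
  -- `a² ≤ (p₁² + p₂²)/2`, `a⁴ ≤ (p₁⁴ + p₂⁴)/2`
  have ha2 : a ^ 2 ≤ (p₁ ^ 2 + p₂ ^ 2) / 2 := by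
    rw [ha, div_pow, sq_abs]; nlinarith [sq_nonneg (p₁ - p₂)]
  have ha4 : a ^ 4 ≤ (p₁ ^ 4 + p₂ ^ 4) / 2 := by
    have h1 : a ^ 4 ≤ ((p₁ ^ 2 + p₂ ^ 2) / 2) ^ 2 := by
      rw [show a ^ 4 = (a ^ 2) ^ 2 by ring]
      exact pow_le_pow_left₀ (sq_nonneg _) ha2 2
    nlinarith [sq_nonneg (p₁ ^ 2 - p₂ ^ 2)]
  -- `r² ≤ 2(q₁² + q₂²)`, `r⁴ ≤ 8(q₁⁴ + q₂⁴)`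
  have hr2 : r ^ 2 ≤ 2 * (q₁ ^ 2 + q₂ ^ 2) := by rw [hr]; nlinarith [sq_nonneg (q₁ + q₂)]
  have hr4 : r ^ 4 ≤ 8 * (q₁ ^ 4 + q₂ ^ 4) := by
    have h1 : r ^ 4 ≤ (2 * (q₁ ^ 2 + q₂ ^ 2)) ^ 2 := by
      rw [show r ^ 4 = (r ^ 2) ^ 2 by ring]
      exact pow_le_pow_left₀ (sq_nonneg _) hr2 2
    nlinarith [sq_nonneg (q₁ ^ 2 - q₂ ^ 2)]
  -- `a|r| ≤ (a² + r²)/2`, `a|r|³ ≤ a⁴/4 + 3r⁴/4`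
  have h1 : a * |r| ≤ (a ^ 2 + r ^ 2) / 2 := by
    have := mul_le_half_add_sq a |r|; rwa [sq_abs] at this
  have h3 : a * |r| ^ 3 ≤ a ^ 4 / 4 + 3 * r ^ 4 / 4 := by
    have e : a * |r| ^ 3 = (a * |r|) * r ^ 2 := by rw [← sq_abs r]; ring
    rw [e]
    have s1 : (a * |r|) * r ^ 2 ≤ ((a ^ 2 + r ^ 2) / 2) * r ^ 2 := mul_le_mul_of_nonneg_right h1 (sq_nonneg _)
    have s2 : a ^ 2 * r ^ 2 ≤ (a ^ 4 + r ^ 4) / 2 := by nlinarith [sq_nonneg (a ^ 2 - r ^ 2)]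
    nlinarith
  have habs : |(p₁ + p₂) / 2 * (r + β * r ^ 3)| ≤ a * |r| + |β| * (a * |r| ^ 3) := by
    rw [abs_mul, abs_div, abs_two, ← ha]
    calc a * |r + β * r ^ 3| ≤ a * (|r| + |β| * |r| ^ 3) := by
          refine mul_le_mul_of_nonneg_left ((abs_add_le _ _).trans ?_) ha0
          rw [abs_mul, abs_pow]
      _ = a * |r| + |β| * (a * |r| ^ 3) := by ring
  calc |(p₁ + p₂) / 2 * (r + β * r ^ 3)| ≤ a * |r| + |β| * (a * |r| ^ 3) := habs
    _ ≤ (a ^ 2 + r ^ 2) / 2 + |β| * (a ^ 4 / 4 + 3 * r ^ 4 / 4) :=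
        add_le_add h1 (mul_le_mul_of_nonneg_left h3 hβ0)
    _ ≤ ((p₁ ^ 2 + p₂ ^ 2) / 2 + 2 * (q₁ ^ 2 + q₂ ^ 2)) / 2 +
        |β| * ((p₁ ^ 4 + p₂ ^ 4) / 2 / 4 + 3 * (8 * (q₁ ^ 4 + q₂ ^ 4)) / 4) := by
        gcongr
    _ ≤ (1 + 6 * |β|) * ((q₁ ^ 2 + p₁ ^ 2 + (q₂ ^ 2 + p₂ ^ 2)) + (q₁ ^ 4 + p₁ ^ 4 + (q₂ ^ 4 + p₂ ^ 4))) := by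
        have e1 : (0:ℝ) ≤ p₁ ^ 4 := by positivity
        have e2 : (0:ℝ) ≤ p₂ ^ 4 := by positivity
        have e3 : (0:ℝ) ≤ q₁ ^ 4 := by positivity
        have e4 : (0:ℝ) ≤ q₂ ^ 4 := by positivity
        nlinarith [sq_nonneg p₁, sq_nonneg p₂, sq_nonneg q₁, sq_nonneg q₂,
          mul_nonneg hβ0 e1, mul_nonneg hβ0 e2, mul_nonneg hβ0 e3, mul_nonneg hβ0 e4,
          mul_nonneg hβ0 (sq_nonneg p₁), mul_nonneg hβ0 (sq_nonneg p₂), mul_nonneg hβ0 (sq_nonneg q₁),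
          mul_nonneg hβ0 (sq_nonneg q₂)]

section Pinned2

variable {ω₂ lam β γ T_L T_R : ℝ}

/-- **Uniform bound for every mean bond current** of the pinned chain (any real parameters) under the
site-uniform moment hypothesis of `WindowLimit`: `|∫ j_i dμ_N| ≤ (1 + 6|β|)(2C₂ + 2C₄)` for all `N`, `i`.
[folklore] -/
theorem pinnedChain_abs_integral_bondCurrent_le (μ : (N : ℕ) → Measure (PhaseSpace N)) {C₂ C₄ : ℝ}
    (h2 : ∀ (N : ℕ) (i : Fin N), Integrable (fun x : PhaseSpace N => |x.1 i| ^ 2 + |x.2 i| ^ 2) (μ N) ∧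
      ∫ x, (|x.1 i| ^ 2 + |x.2 i| ^ 2) ∂(μ N) ≤ C₂)
    (h4 : ∀ (N : ℕ) (i : Fin N), Integrable (fun x : PhaseSpace N => |x.1 i| ^ 4 + |x.2 i| ^ 4) (μ N) ∧
      ∫ x, (|x.1 i| ^ 4 + |x.2 i| ^ 4) ∂(μ N) ≤ C₄)
    (N : ℕ) (i : Fin N) :
    |∫ x, (pinnedChain ω₂ lam β γ).bondCurrent N i x ∂(μ N)| ≤ (1 + 6 * |β|) * (2 * C₂ + 2 * C₄) := by
  by_cases hi : i.val + 1 < N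
  · set j : Fin N := ⟨i.val + 1, hi⟩ with hj
    set G : PhaseSpace N → ℝ := fun x => (1 + 6 * |β|) *
      ((|x.1 i| ^ 2 + |x.2 i| ^ 2 + (|x.1 j| ^ 2 + |x.2 j| ^ 2)) +
        (|x.1 i| ^ 4 + |x.2 i| ^ 4 + (|x.1 j| ^ 4 + |x.2 j| ^ 4))) with hG
    have hGi : Integrable G (μ N) := (((h2 N i).1.add (h2 N j).1).add ((h4 N i).1.add (h4 N j).1)).const_mul _
    have hle : ∀ x, |(pinnedChain ω₂ lam β γ).bondCurrent N i x| ≤ G x := by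
      intro x
      rw [bondCurrent_eq_dite, dif_pos hi, pinnedChain_deriv_V, abs_neg]
      exact abs_bondCurrent_term_le β (x.2 i) (x.2 j) (x.1 i) (x.1 j)
    calc |∫ x, (pinnedChain ω₂ lam β γ).bondCurrent N i x ∂(μ N)| ≤ ∫ x, G x ∂(μ N) := by
          rw [← Real.norm_eq_abs]
          exact norm_integral_le_of_norm_le hGi (Eventually.of_forall fun x => by
            rw [Real.norm_eq_abs]; exact hle x)
      _ = (1 + 6 * |β|) * ((∫ x, (|x.1 i| ^ 2 + |x.2 i| ^ 2) ∂(μ N) + ∫ x, (|x.1 j| ^ 2 + |x.2 j| ^ 2) ∂(μ N)) +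
          (∫ x, (|x.1 i| ^ 4 + |x.2 i| ^ 4) ∂(μ N) + ∫ x, (|x.1 j| ^ 4 + |x.2 j| ^ 4) ∂(μ N))) := by
          rw [hG, integral_const_mul]
          congr 1
          have hA : Integrable (fun x : PhaseSpace N => |x.1 i| ^ 2 + |x.2 i| ^ 2) (μ N) := (h2 N i).1
          have hB : Integrable (fun x : PhaseSpace N => |x.1 j| ^ 2 + |x.2 j| ^ 2) (μ N) := (h2 N j).1
          have hC : Integrable (fun x : PhaseSpace N => |x.1 i| ^ 4 + |x.2 i| ^ 4) (μ N) := (h4 N i).1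
          have hD : Integrable (fun x : PhaseSpace N => |x.1 j| ^ 4 + |x.2 j| ^ 4) (μ N) := (h4 N j).1
          have hAB : Integrable (fun x : PhaseSpace N => |x.1 i| ^ 2 + |x.2 i| ^ 2 + (|x.1 j| ^ 2 + |x.2 j| ^ 2)) (μ N) :=
            hA.add hB
          have hCD : Integrable (fun x : PhaseSpace N => |x.1 i| ^ 4 + |x.2 i| ^ 4 + (|x.1 j| ^ 4 + |x.2 j| ^ 4)) (μ N) :=
            hC.add hD
          rw [integral_add hAB hCD, integral_add hA hB, integral_add hC hD]
      _ ≤ (1 + 6 * |β|) * (2 * C₂ + 2 * C₄) := by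
          refine mul_le_mul_of_nonneg_left ?_ (by positivity)
          linarith [(h2 N i).2, (h2 N j).2, (h4 N i).2, (h4 N j).2]
  · have h0 : ∀ x, (pinnedChain ω₂ lam β γ).bondCurrent N i x = 0 := fun x => by
      rw [bondCurrent_eq_dite, dif_neg hi]
    simp only [h0, integral_zero, abs_zero]
    -- the constant is nonnegative as soon as the chain has a site (here `i` is one)
    have hC2 : 0 ≤ C₂ := le_trans (integral_nonneg fun x => by positivity) (h2 N i).2
    have hC4 : 0 ≤ C₄ := le_trans (integral_nonneg fun x => by positivity) (h4 N i).2
    positivity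

/-- **The centre current carries the ballistic part of the total current**: for the pinned chain with
ARBITRARY real parameters and a family of weak steady states with site-uniform moments, there is `B`
(uniform in `N`) with `(N-1)|totalCurrent(μ_N)/(N-1)| ≤ (N-3)|J_centre(μ_N)| + B` for all `N ≥ 6`:
the `N - 3` bulk bonds `1, …, N-3` all carry the centre current, the two boundary bonds `0` and `N-2` are
bounded by the moments, and the last index carries no bond. [Bonetto–Lebowitz–Rey-Bellet 2000, §5.2
eqs. (25)–(27)] [folklore] -/
theorem centre_current_lower_bound (μ : (N : ℕ) → Measure (PhaseSpace N))
    (hss : ∀ N, (pinnedChain ω₂ lam β γ).IsSteadyState N T_L T_R (μ N))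
    (hmom : ∀ m : ℕ, ∃ C : ℝ, ∀ (N : ℕ) (i : Fin N),
      Integrable (fun x : PhaseSpace N => |x.1 i| ^ m + |x.2 i| ^ m) (μ N) ∧
        ∫ x, (|x.1 i| ^ m + |x.2 i| ^ m) ∂(μ N) ≤ C) :
    ∃ B : ℝ, ∀ (N : ℕ) (_hN : 6 ≤ N),
      ((N : ℝ) - 1) * |(pinnedChain ω₂ lam β γ).totalCurrent (μ N) / ((N : ℝ) - 1)| ≤
        ((N : ℝ) - 3) * |centreCurrent (pinnedChain ω₂ lam β γ) (μ N)| + B := by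
  set P := pinnedChain ω₂ lam β γ with hP
  obtain ⟨C₂, h2⟩ := hmom 2
  obtain ⟨C₄, h4⟩ := hmom 4
  set B₀ : ℝ := (1 + 6 * |β|) * (2 * C₂ + 2 * C₄) with hB₀
  refine ⟨2 * B₀, fun N hN => ?_⟩
  have hN0 : 0 < N := by omega
  have hmomN : ∀ (K : ℕ) (i : Fin N), Integrable (fun x : PhaseSpace N => |x.1 i| ^ K + |x.2 i| ^ K) (μ N) :=
    fun K i => by obtain ⟨C, hC⟩ := hmom K; exact (hC N i).1
  -- the bond currents as a sequence indexed by `ℕ`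
  set b : ℕ → ℝ := fun k => if h : k < N then ∫ x, P.bondCurrent N ⟨k, h⟩ x ∂(μ N) else 0 with hb
  set J : ℝ := centreCurrent P (μ N) with hJ
  have hJ' : J = ∫ x, P.bondCurrent N ⟨N / 2, Nat.div_lt_self hN0 one_lt_two⟩ x ∂(μ N) := by
    rw [hJ, centreCurrent_eq P hN0]
  have hbulk : ∀ k : ℕ, 1 ≤ k → k + 3 ≤ N → b k = J := by
    intro k hk1 hk2
    have hkN : k < N := by omega
    rw [hb]; simp only [dif_pos hkN]
    rw [hJ']
    rcases le_total k (N / 2) with hle | hle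
    · exact pinnedChain_integral_bondCurrent_eq_of_bulk ω₂ lam β γ T_L T_R (hss N) hmomN ⟨k, hkN⟩
        ⟨N / 2, _⟩ hk1 hle (by simp only; omega)
    · exact (pinnedChain_integral_bondCurrent_eq_of_bulk ω₂ lam β γ T_L T_R (hss N) hmomN ⟨N / 2, _⟩
        ⟨k, hkN⟩ (by simp only; omega) hle hk2).symm
  have hlast : b (N - 1) = 0 := by
    have hlt : N - 1 < N := Nat.sub_lt hN0 one_pos
    have h0 : ∀ x, P.bondCurrent N ⟨N - 1, hlt⟩ x = 0 := fun x => by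
      rw [bondCurrent_eq_dite, dif_neg (show ¬ ((⟨N - 1, hlt⟩ : Fin N).val + 1 < N) from
        fun h => by change N - 1 + 1 < N at h; omega)]
    rw [hb]; simp only [dif_pos hlt, h0, integral_zero]
  -- the total current, decomposed
  have htot : P.totalCurrent (μ N) = ∑ k ∈ Finset.range N, b k := by
    unfold OscillatorChain.totalCurrent
    rw [← Fin.sum_univ_eq_sum_range]
    refine Finset.sum_congr rfl fun i _ => ?_
    rw [hb]; simp only [dif_pos i.isLt]
  have hdecomp : ∑ k ∈ Finset.range N, b k = b 0 + ((N : ℝ) - 3) * J + b (N - 2) + b (N - 1) := by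
    obtain ⟨M, hM⟩ : ∃ M, N = M + 2 := ⟨N - 2, by omega⟩
    have hM1 : 1 ≤ M := by omega
    rw [hM, Finset.sum_range_succ, Finset.sum_range_succ, Finset.range_eq_Ico,
      Finset.sum_eq_sum_Ico_succ_bot (by omega : 0 < M)]
    have hmid : ∑ k ∈ Finset.Ico (0 + 1) M, b k = ∑ _k ∈ Finset.Ico (0 + 1) M, J := by
      refine Finset.sum_congr rfl fun k hk => ?_
      rw [Finset.mem_Ico] at hk
      exact hbulk k hk.1 (by omega)
    rw [hmid, Finset.sum_const, Nat.card_Ico, nsmul_eq_mul]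
    have e1 : ((M - (0 + 1) : ℕ) : ℝ) = ((M + 2 : ℕ) : ℝ) - 3 := by
      rw [Nat.cast_sub (by omega)]; push_cast; ring
    have e2 : M + 2 - 2 = M := by omega
    have e3 : M + 2 - 1 = M + 1 := by omega
    rw [e1, e2, e3]
  -- the estimate
  have hB0 : |b 0| ≤ B₀ := by
    rw [hb]; simp only [dif_pos hN0]
    exact pinnedChain_abs_integral_bondCurrent_le μ h2 h4 N _
  have hB2 : |b (N - 2)| ≤ B₀ := by
    rw [hb]; simp only [dif_pos (show N - 2 < N by omega)]
    exact pinnedChain_abs_integral_bondCurrent_le μ h2 h4 N _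
  have hN1 : (0 : ℝ) < (N : ℝ) - 1 := by
    have : (6 : ℝ) ≤ N := by exact_mod_cast hN
    linarith
  have hN3 : (0 : ℝ) ≤ (N : ℝ) - 3 := by
    have : (6 : ℝ) ≤ N := by exact_mod_cast hN
    linarith
  have hlhs : ((N : ℝ) - 1) * |P.totalCurrent (μ N) / ((N : ℝ) - 1)| = |P.totalCurrent (μ N)| := by
    rw [abs_div, abs_of_pos hN1, mul_div_cancel₀ _ hN1.ne']
  rw [hlhs, htot, hdecomp, hlast, add_zero]
  calc |b 0 + ((N : ℝ) - 3) * J + b (N - 2)| ≤ |b 0 + ((N : ℝ) - 3) * J| + |b (N - 2)| := abs_add_le _ _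
    _ ≤ |b 0| + |((N : ℝ) - 3) * J| + |b (N - 2)| := add_le_add (abs_add_le _ _) le_rfl
    _ = |b 0| + ((N : ℝ) - 3) * |J| + |b (N - 2)| := by rw [abs_mul, abs_of_nonneg hN3]
    _ ≤ B₀ + ((N : ℝ) - 3) * |J| + B₀ := by linarith
    _ = ((N : ℝ) - 3) * |J| + 2 * B₀ := by ring

end Pinned2

end Summit.AtomisticToContinuum.FouriersLaw.Theorems.WindowLimit

end
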